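import Summits.PneNP.PneNP.Theses.PlantedClique
import Literature.Probability.RandomGraphs.PlantedCliqueUnique

/-!
# Route PlantedClique — `PlantedcliqueUniqueClique` (stmt-PneNP-8687)

Uniqueness of the planted clique at `k_ε = ⌈n^{1/2−ε}⌉₊`, `0 < ε < 1/2`: the planted set is the unique maximum clique of
`G(n,1/2,k_ε)` with probability `→ 1`. From the tree's first-moment bound `one_sub_le_uniqueMaxCliqueProb`
(failure `≤ n³·2^{−⌊(k−1)/2⌋}` for `1 ≤ k ≤ n`) exactly as `plantedCliqueUniqueWhp_of_sqrt_le`, with the estimate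
`n³ 2^{−⌊(k_ε−1)/2⌋} ≤ 2 n³ e^{−(log 2/2) n^c} → 0`, `c = 1/2 − ε > 0` (`x^{3/c} e^{−bx} → 0` at `x = n^c`).
-/

set_option linter.dupNamespace false -- `Summit.PneNP.PneNP.…`: summit = sub-problem name (D-0017 single-conjunct layout)

namespace Summit.PneNP.PneNP.Theorems

open Filter Topology
open scoped ENNReal
open Literature.Probability.RandomGraphs.PlantedClique

/-- **Support item `PlantedcliqueUniqueClique` of route PlantedClique (stmt-PneNP-8687)**: for `0 < ε < 1/2` the planted
`⌈n^{1/2−ε}⌉₊`-clique is the unique maximum clique with high probability (`PlantedCliqueUniqueWhp`), by the first-moment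
bound `one_sub_le_uniqueMaxCliqueProb` and `n³ 2^{−⌊(k−1)/2⌋} → 0` for `k ≥ n^{1/2−ε}`.
[cite: AlonKrivelevichSudakov1998, §1] [cite: Jerrum1992, §1] -/
theorem plantedClique_uniqueClique_proof : Summit.PneNP.PneNP.Theses.PlantedClique.PlantedcliqueUniqueClique := by
  unfold Summit.PneNP.PneNP.Theses.PlantedClique.PlantedcliqueUniqueClique
  intro ε hε hε2
  unfold Literature.Probability.RandomGraphs.PlantedClique.PlantedCliqueUniqueWhp
  set k : ℕ → ℕ := fun n => ⌈(n : ℝ) ^ (1 / 2 - ε)⌉₊ with hk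
  set c : ℝ := 1 / 2 - ε with hc
  have hcpos : 0 < c := by rw [hc]; linarith
  have hc1 : c ≤ 1 := by rw [hc]; linarith
  -- basic facts for `n ≥ 1`
  have hkn : ∀ n : ℕ, 1 ≤ n → 1 ≤ k n ∧ k n ≤ n ∧ (n : ℝ) ^ c ≤ k n := by
    intro n hn
    have hnpos : (0 : ℝ) < n := by exact_mod_cast hn
    refine ⟨Nat.ceil_pos.2 (Real.rpow_pos_of_pos hnpos _), Nat.ceil_le.2 ?_, Nat.le_ceil _⟩
    calc (n : ℝ) ^ c ≤ (n : ℝ) ^ (1 : ℝ) := Real.rpow_le_rpow_of_exponent_le (by exact_mod_cast hn) hc1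
      _ = n := Real.rpow_one _
  -- the error term tends to `0` (real form)
  have hreal : Tendsto (fun n : ℕ => (n : ℝ) ^ 3 * 2⁻¹ ^ ((k n - 1) / 2)) atTop (𝓝 0) := by
    have hlog : 0 < Real.log 2 := Real.log_pos one_lt_two
    have hb : 0 < Real.log 2 / 2 := by positivity
    have hx : Tendsto (fun n : ℕ => (n : ℝ) ^ c) atTop atTop :=
      (tendsto_rpow_atTop hcpos).comp tendsto_natCast_atTop_atTop
    have hlim0 := ((tendsto_rpow_mul_exp_neg_mul_atTop_nhds_zero (3 / c) (Real.log 2 / 2) hb).comp hx).const_mul 2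
    rw [mul_zero] at hlim0
    have hlim : Tendsto (fun n : ℕ => 2 * ((((n : ℝ) ^ c) ^ (3 / c)) *
        Real.exp (-(Real.log 2 / 2) * (n : ℝ) ^ c))) atTop (𝓝 0) := hlim0
    refine squeeze_zero' (Eventually.of_forall fun n => by positivity) ?_ hlim
    filter_upwards [eventually_ge_atTop 1] with n hn
    obtain ⟨-, -, hkc⟩ := hkn n hn
    have hnpos : (0 : ℝ) < n := by exact_mod_cast hn
    have hn3 : ((n : ℝ) ^ c) ^ (3 / c) = (n : ℝ) ^ 3 := by
      rw [← Real.rpow_mul hnpos.le, show c * (3 / c) = ((3 : ℕ) : ℝ) by field_simp; norm_num, Real.rpow_natCast]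
    set m := (k n - 1) / 2 with hm
    have h2m : (n : ℝ) ^ c ≤ 2 * m + 2 := by
      have h1 : k n ≤ 2 * m + 2 := by omega
      have h2 : (k n : ℝ) ≤ 2 * m + 2 := by exact_mod_cast h1
      exact hkc.trans h2
    have hpow : (2⁻¹ : ℝ) ^ m = Real.exp (-(Real.log 2 * m)) := by
      rw [Real.exp_neg, mul_comm, Real.exp_nat_mul, Real.exp_log two_pos, inv_pow]
    have hexp : Real.exp (-(Real.log 2 * m)) ≤ 2 * Real.exp (-(Real.log 2 / 2) * (n : ℝ) ^ c) := by
      rw [show (2 : ℝ) * Real.exp (-(Real.log 2 / 2) * (n : ℝ) ^ c) =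
          Real.exp (Real.log 2 + -(Real.log 2 / 2) * (n : ℝ) ^ c) by
            rw [Real.exp_add, Real.exp_log two_pos]]
      refine Real.exp_le_exp.2 ?_
      have : Real.log 2 * (n : ℝ) ^ c ≤ Real.log 2 * (2 * m + 2) := mul_le_mul_of_nonneg_left h2m hlog.le
      nlinarith
    rw [hn3]
    calc (n : ℝ) ^ 3 * 2⁻¹ ^ m = (n : ℝ) ^ 3 * Real.exp (-(Real.log 2 * m)) := by rw [hpow]
      _ ≤ (n : ℝ) ^ 3 * (2 * Real.exp (-(Real.log 2 / 2) * (n : ℝ) ^ c)) := by gcongr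
      _ = 2 * ((n : ℝ) ^ 3 * Real.exp (-(Real.log 2 / 2) * (n : ℝ) ^ c)) := by ring
  -- the error term in `ℝ≥0∞`
  set δ : ℕ → ℝ≥0∞ := fun n => (n : ℝ≥0∞) ^ 3 * 2⁻¹ ^ ((k n - 1) / 2) with hδ
  have hδeq : ∀ n : ℕ, δ n = ENNReal.ofReal ((n : ℝ) ^ 3 * 2⁻¹ ^ ((k n - 1) / 2)) := by
    intro n
    rw [hδ, ENNReal.ofReal_mul (by positivity), ENNReal.ofReal_pow (Nat.cast_nonneg _),
      ENNReal.ofReal_natCast, ENNReal.ofReal_pow (by norm_num),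
      ENNReal.ofReal_inv_of_pos two_pos, ENNReal.ofReal_ofNat]
  have hδlim : Tendsto δ atTop (𝓝 0) := by
    have h := ENNReal.tendsto_ofReal hreal
    rw [ENNReal.ofReal_zero] at h
    exact h.congr fun n => (hδeq n).symm
  -- squeeze between `1 - δ n` and `1`
  have hlow : Tendsto (fun n => 1 - δ n) atTop (𝓝 1) := by
    have h := ENNReal.Tendsto.sub (tendsto_const_nhds (x := (1 : ℝ≥0∞))) hδlim
      (Or.inl ENNReal.one_ne_top)
    rwa [tsub_zero] at h
  refine tendsto_of_tendsto_of_tendsto_of_le_of_le' hlow tendsto_const_nhds ?_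
    (Eventually.of_forall fun n => ?_)
  · filter_upwards [eventually_ge_atTop 1] with n hn
    obtain ⟨hk1, hkle, -⟩ := hkn n hn
    exact one_sub_le_uniqueMaxCliqueProb hk1 hkle
  · refine le_trans ((plantedCliqueJoint n (k n)).toOuterMeasure.mono (Set.subset_univ _)) ?_
    exact ((PMF.toOuterMeasure_apply_eq_one_iff _ _).2 (Set.subset_univ _)).le

end Summit.PneNP.PneNP.Theorems
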